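import Summits.QuantumFields.YangMills.Theorems.BalabanUVNodesN15KingModelLandauScaling
import Summits.QuantumFields.YangMills.Theorems.BalabanUVNodesN15KingModelLandauStability
import Summits.QuantumFields.YangMills.Theorems.BalabanUVNodesN15KingModelLandauTight
import Summits.QuantumFields.YangMills.Theorems.BalabanUVNodesN15KingModelLandauHarper
import Summits.QuantumFields.YangMills.Theorems.BalabanUVNodesN15KingModelLandauBlockPenalty
import HarnessLib

/-!
# BalabanUVNodes ∕ N15 — THE KING-MODEL RUNG (PART Ϡ-j): PART Ϡ «THE LATTICE LANDAU LEVEL» BY NAME — one conjunction for the referee: the fibre bound, the torus bound, the curvature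
# mass of King's covariant fine operator at constant flux (LINEAR in the flux angle), its η-rate and continuum limit `B∕2`, gauge invariance ∕ stability, the two-sided Landau scaling,
# the Harper fibres, and the full-operator shape with any block penalty; plus «what the curved case adds» in one line
# (Track A, DAG node N15 = NE2; FAN-OUT v1.1 §N15 s3 «KING-MODEL RUNG … + what the curved case adds»; count-neutral)

HONEST FRAMING.  Count-neutral (cell `pub-ymgap`, seat `pub-ymgap-dag-n15-e` g47; `--supports stmt-QuantumFields-27247 --as helper` = K3ᴬ, KEY MAP v3).  Packaging only (every conjunct is a
landed theorem of PARTS Ϡ-a…Ϡ-i, cited by name).  King's fine covariance layer `−cΔ_U + m²` ([King1986] (4.4) p.670; [Balaban1985BackgroundPropagators] (3.23) p.394) at the `U(1)`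
constant-flux field (Landau gauge) on ONE finite torus per spacing; NOT Bałaban's `G_k(U)` with his covariant `Q(U)` (only the shape `Δ_U + aQ^*Q` for arbitrary `Q`); NOT [B9] (3.42); NOT a
node discharge (N15 of record untouched); nothing continuum-YM ∕ ℝ⁴ ∕ OS ∕ Clay.  The constant `½` in `Λ(θ) = |sin θ|∕2 − (1−cos θ)²∕4` is half the true Landau level (numerics in Ϡ-a's header).
Locators: [King1986] (4.4) p.670, (2.12) p.653, (3.73) p.665, (4.38) p.674; [Balaban1985BackgroundPropagators] (3.3) p.391, (3.23)–(3.24) p.394, (3.35)–(3.39) p.397, p.398 l.19;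
[HornJohnson2013] Thm 4.2.2; [DodziukMathai2006] §1 Cor 1.3 (notion); [LandauLifshitzQM] §112 (notion).  0 `sorry`, 0 `def`.
-/

noncomputable section
open scoped BigOperators ComplexConjugate ComplexOrder Topology Matrix.Norms.L2Operator
open Finset Matrix WithLp Filter

namespace Summit.QuantumFields.YangMills.BalabanUVNodes.N15KingModelRung.Landau

open Literature.MathematicalPhysics.QuantumFieldTheory.LatticeDiamagneticInequality (Hopping)
open Literature.MathematicalPhysics.QuantumFieldTheory.Balaban1983to89.B5Prop11Plancherel (Tor unitVec chi sOf)
open Summit.QuantumFields.YangMills.BalabanUVNodes.N15KingModelRung.Covariant (covLapF fib isHermitian_covLapF kingGaugeAct not_posDef_covLapF_massless_free)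
open Summit.QuantumFields.YangMills.BalabanUVNodes.N15KingModelRung.Cover (fluxLink)
open Summit.QuantumFields.YangMills.BalabanUVNodes.N15KingModelRung.Curvature (harperOp)

variable {d : ℕ} (K : Fin (d + 1) → ℕ) [hK : ∀ μ, NeZero (K μ)]

/-- ★★★ **PART Ϡ «THE LATTICE LANDAU LEVEL» BY NAME** (`c > 0`, `ν₀ ≠ ν₁`; `Λ = landauGap`, `p′ = sOf K p`): (1) the torus bound in the Landau gauge (Ϡ-b); (2) the curvature mass of King's
covariant fine operator at the flux field, linear in the flux (Ϡ-c); (3) the better of the plaquette and Landau roads (Ϡ-c∕Ϳ-c); (4) the η-rate `|η⁻²Λ(Bη²) − B∕2| ≤ B³η⁴∕12 + B⁴η⁶∕16` and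
(5) the continuum limit `η⁻²Λ(Bη²) → B∕2` (Ϡ-d); (6) the Landau mass on an `ε`-tube around the gauge orbit (Ϡ-e); (7) the two-sided scaling `cθ∕4 ≤ λ_min − m² ≤ 13cθ` (Ϡ-g); (8) every
Harper fibre above the Landau level (Ϡ-h); (9) the full-operator shape with any block penalty (Ϡ-i).
[cite: King1986, (4.4) p.670, (2.12) p.653, (4.38) p.674; Balaban1985BackgroundPropagators, (3.23) p.394, (3.35) p.397; HornJohnson2013, Thm 4.2.2] -/
theorem king_landau_package {c : ℝ} (hc : 0 < c) {ν₀ ν₁ : Fin (d + 1)} (hν : ν₀ ≠ ν₁) :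
    (∀ {p : Tor K} (_hp : p ν₁ = 0) (w : Tor K → ℂ),
        landauGap (sOf K p ν₀) * ∑ x, ‖w x‖ ^ 2 ≤ ∑ x, (‖w x - w (x + unitVec K ν₀)‖ ^ 2 + ‖w x - chi K p x * w (x + unitVec K ν₁)‖ ^ 2))
    ∧ (∀ (m2 : ℝ) {p : Tor K} (_hp : p ν₁ = 0) (v : Tor K × Unit → ℂ),
        (m2 + c * landauGap (sOf K p ν₀)) * ∑ x, ‖fib K v x‖ ^ 2 ≤ (star v ⬝ᵥ (covLapF K c m2 (fluxLink K p ν₁) *ᵥ v)).re)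
    ∧ (∀ (m2 : ℝ) {p : Tor K} (_hp : p ν₁ = 0) (v : Tor K × Unit → ℂ),
        (m2 + c * max (2 * (2 - 2 * Real.cos (sOf K p ν₀ / 4))) (landauGap (sOf K p ν₀))) * ∑ x, ‖fib K v x‖ ^ 2 ≤ (star v ⬝ᵥ (covLapF K c m2 (fluxLink K p ν₁) *ᵥ v)).re)
    ∧ (∀ {η B : ℝ}, 0 < η → 0 ≤ B → B * η ^ 2 ≤ 1 → |η⁻¹ ^ 2 * landauGap (B * η ^ 2) - B / 2| ≤ B ^ 3 * η ^ 4 / 12 + B ^ 4 * η ^ 6 / 16)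
    ∧ (∀ {B : ℝ}, 0 ≤ B → Tendsto (fun η : ℝ => η⁻¹ ^ 2 * landauGap (B * η ^ 2)) (𝓝[>] 0) (𝓝 (B / 2)))
    ∧ (∀ (m2 : ℝ) {p : Tor K} (_hp : p ν₁ = 0) {g : Tor K → Matrix Unit Unit ℂ} (_hg : ∀ x, g x ∈ Matrix.unitaryGroup Unit ℂ)
        {V : Tor K × Fin (d + 1) → Matrix Unit Unit ℂ} (_hV : ∀ b, V b ∈ Matrix.unitaryGroup Unit ℂ) {ε : ℝ} (_hε : ∀ b, ‖V b - kingGaugeAct K g (fluxLink K p ν₁) b‖ ≤ ε)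
        (v : Tor K × Unit → ℂ),
        (m2 + c * landauGap (sOf K p ν₀) - 4 * ((d : ℝ) + 1) * c * ε) * ∑ x, ‖fib K v x‖ ^ 2 ≤ RCLike.re (star v ⬝ᵥ (covLapF K c m2 V *ᵥ v)))
    ∧ (∀ (m2 : ℝ) {p : Tor K} (_hp : ∀ μ, μ ≠ ν₀ → p μ = 0) (_hθ0 : 0 < sOf K p ν₀) (_hθ1 : sOf K p ν₀ ≤ 1) (_hbig : 4 ≤ sOf K p ν₀ * ((K ν₀ / 2 : ℕ) : ℝ) ^ 2),
        (∀ i, m2 + c * (sOf K p ν₀ / 4) ≤ (isHermitian_covLapF K c m2 (fluxLink K p ν₁)).eigenvalues i)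
          ∧ ∃ i, (isHermitian_covLapF K c m2 (fluxLink K p ν₁)).eigenvalues i ≤ m2 + 13 * c * sOf K p ν₀)
    ∧ (∀ (m2 : ℝ) (p q : Tor K) (f : ZMod (K ν₀) → ℂ),
        (m2 + c * landauGap (sOf K p ν₀)) * ∑ j, ‖f j‖ ^ 2 ≤ (∑ j, conj (f j) * harperOp K c m2 ν₀ ν₁ p q f j).re)
    ∧ (∀ (m2 : ℝ) {p : Tor K} (_hp : p ν₁ = 0) {ι : Type} [Fintype ι] {a : ℝ} (_ha : 0 ≤ a) (Q : Matrix ι (Tor K × Unit) ℂ) (v : Tor K × Unit → ℂ),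
        (m2 + c * landauGap (sOf K p ν₀)) * ∑ x, ‖fib K v x‖ ^ 2 ≤ RCLike.re (star v ⬝ᵥ ((covLapF K c m2 (fluxLink K p ν₁) + (a : ℂ) • (Qᴴ * Q)) *ᵥ v))) :=
  ⟨fun hp w => landau_torus_bound K ν₀ hp w,
    fun m2 _ hp v => re_quadForm_covLapF_fluxLink_ge_landau K hc.le m2 hν hp v,
    fun m2 _ hp v => re_quadForm_covLapF_fluxLink_ge_best K hc.le m2 hν hp v,
    fun hη hB hBη => abs_landauScaled_sub_half_le hη hB hBη,
    fun hB => tendsto_landauScaled hB,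
    fun m2 _ hp _ hg _ hV _ hε v => re_quadForm_covLapF_ge_landau_near_orbit K hc.le m2 hν hp hg hV hε v,
    fun m2 _ hp hθ0 hθ1 hbig => landau_two_sided K hc.le m2 hν hp hθ0 hθ1 hbig,
    fun m2 p q f => re_form_harperOp_ge_landau' K hc.le m2 hν p q f,
    fun m2 _ hp _ _ _ ha Q v => re_quadForm_fullOp_fluxLink_ge_landau K hc.le m2 hν hp ha Q v⟩

/-- ★★★ **WHAT THE CURVED CASE ADDS, IN ONE LINE** (`c > 0`, `ν₀ ≠ ν₁`, `p_{ν₁} = 0`, `p_{ν₀} ≠ 0`, `|p′_{ν₀}| ≤ 1`): King's own massless operator `c(−Δ) ⊗ 1` (`U ≡ 1`) is NOT positive definite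
(the constants are zero modes, Ͱ-d), while at the constant-flux field the massless covariant Laplacian IS positive definite with EVERY eigenvalue `≥ c|p′_{ν₀}|∕4` — LINEAR in the curvature;
and in King's units (`c = η⁻²`, physical curvature `B`, `θ = Bη²`) PART Ϳ's plaquette mass tends to `0` while the Landau mass tends to `B∕2`: the curved case adds an η-UNIFORM mass.
[cite: King1986, (4.4) p.670; Balaban1985BackgroundPropagators, (3.23) p.394, (3.35) p.397; DodziukMathai2006, Cor 1.3 §1] -/
theorem king_landau_what_the_curved_case_adds {c : ℝ} (hc : 0 < c) {p : Tor K} {ν₀ ν₁ : Fin (d + 1)} (hν : ν₀ ≠ ν₁) (hp : p ν₁ = 0) (hp0 : p ν₀ ≠ 0) (hsmall : |sOf K p ν₀| ≤ 1) :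
    ¬ (covLapF K c 0 (Hopping.free : Tor K × Fin (d + 1) → Matrix Unit Unit ℂ)).PosDef
    ∧ (covLapF K c 0 (fluxLink K p ν₁)).PosDef
    ∧ (∀ i, c * (|sOf K p ν₀| / 4) ≤ (isHermitian_covLapF K c 0 (fluxLink K p ν₁)).eigenvalues i)
    ∧ (∀ B : ℝ, Tendsto (fun η : ℝ => 2 * η⁻¹ ^ 2 * (2 - 2 * Real.cos (B * η ^ 2 / 4))) (𝓝[>] 0) (𝓝 0))
    ∧ (∀ {B : ℝ}, 0 ≤ B → Tendsto (fun η : ℝ => η⁻¹ ^ 2 * landauGap (B * η ^ 2)) (𝓝[>] 0) (𝓝 (B / 2))) :=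
  ⟨not_posDef_covLapF_massless_free K hc, posDef_covLapF_fluxLink_massless_landau K hc hν hp hp0 hsmall,
    fun i => by have h := eigenvalues_covLapF_fluxLink_ge_quarter K hc.le 0 hν hp hsmall i; rwa [zero_add] at h,
    fun B => tendsto_plaquetteScaled B, fun hB => tendsto_landauScaled hB⟩

end Summit.QuantumFields.YangMills.BalabanUVNodes.N15KingModelRung.Landau

end
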